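import Summits.AtomisticToContinuum.Crystallization.Theorems.FrustratedLawDichotomyCellCheckerSound
import Summits.AtomisticToContinuum.Crystallization.Theorems.FrustratedLawDichotomyPeriodicBlockViolationBad

/-!
# FrustratedLawDichotomy · crux `AperiodicFrustratedLawGap` (stmt-AtomisticToContinuum-27623) — CELL CERTIFICATE CHECKER, ALL-BAD classes
# (the T′♭ format: interior sites `1/8`-bad by the radial obstruction) (decomp-a2c, prover hand 1, generation 15; critic row 564 (i))

`ClassCertBad` = nearest-neighbour squared numerator `Qn`, an nn witness, a FAR witness at radius in `[9/8·d, 13/10·d)` and the site-sum bound `Ub`;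
`checkClassBad` = the pinning scan + the three witnesses + the class site sum; `class_sound_bad` ⟹ `¬ MaybeGoodAt (1/8) 2`, `¬ MaybeGoodAt (1/20) 2`
(both from `…CellKitF.not_maybeGoodAt_of_radial`: a twelfth neighbour at `≥ 9/8·d` defeats every fit at either tolerance) and `Σ_q W₄₅ ≤ Ub`;
★ `not_schurTopologicalPricing_fourHalf_of_checkBad`: `checkGeom ∧ (∀ m, checkClassBad m) ∧ Σ_m ((Ub_m + 3/200)/2 − 3/400) < N₀·(eUp + κ_T)`
⟹ `¬ SchurTopologicalPricing (1/20) (1/8) w₄₅ ω₄ (3/400) eUp κ_T C_T` for every `C_T` (via `…PeriodicBlockViolationBad.not_schurTopologicalPricing_of_badCell`).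
All `[folklore]`; 0 sorry.
-/

noncomputable section

namespace Summit.AtomisticToContinuum.Crystallization.Theorems.FrustratedLawDichotomyCellChecker

open scoped BigOperators RealInnerProductSpace
open Literature.Geometry.DiscreteGeometry (intVec sqNormInt norm_intVec)
open Summit.AtomisticToContinuum.Crystallization.Theorems.ChargedEnergyGapNegative (E3)
open Summit.AtomisticToContinuum.Crystallization.Theorems.FrustratedLawDichotomyMotifDoorE (MaybeGoodAt)
open Summit.AtomisticToContinuum.Crystallization.Theorems.FrustratedLawDichotomySchurCut
open Summit.AtomisticToContinuum.Crystallization.Theorems.FrustratedLawDichotomyPeriodicBlockKernel (superMotif PerSep DiamLE)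
open Summit.AtomisticToContinuum.Crystallization.Theorems.FrustratedLawDichotomyPeriodicBlockViolationBad (not_schurTopologicalPricing_of_badCell)
open Summit.AtomisticToContinuum.Crystallization.Theorems.FrustratedLawDichotomyCellKitW
open Summit.AtomisticToContinuum.Crystallization.Theorems.FrustratedLawDichotomyCellKitF

/-- An all-bad class certificate: nn squared numerator, nn witness, far witness (`≥ 9/8·d`), site-sum bound. -/
structure ClassCertBad (N₀ K3 : ℕ) where
  /-- nearest-neighbour squared numerator -/
  Qn : ℕ
  /-- nearest-neighbour witness -/
  nn : Fin N₀ × Fin K3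
  /-- far witness -/
  far : Fin N₀ × Fin K3
  /-- claimed upper bound of the class site sum -/
  Ub : ℚ

namespace Cell

variable (c : Cell)

/-- ALL-BAD CLASS CHECK for class `m`: `n(nn) = Qn > 0`, `Qn ≤ 4·DEN²`, far witness `81·Qn ≤ 64·n(far)`, `100·n(far) < 169·Qn`, the pinning scan
`n = 0 ∨ Qn ≤ n` over the supercell, and the class site sum `≤ Ub`. -/
def checkClassBad (m : Fin c.N₀) (C : ClassCertBad c.N₀ c.K3) : Bool :=
  decide (0 < C.Qn) &&
  decide (c.nN m C.nn.1 C.nn.2 = C.Qn) &&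
  decide ((C.Qn : ℚ) ≤ 4 * (c.DEN : ℚ) ^ 2) &&
  decide (81 * (C.Qn : ℤ) ≤ 64 * c.nN m C.far.1 C.far.2 ∧ 100 * c.nN m C.far.1 C.far.2 < 169 * (C.Qn : ℤ)) &&
  decide (∀ m' : Fin c.N₀, allBelow (fun t => decide (c.nN m m' t = 0) || decide ((C.Qn : ℤ) ≤ c.nN m m' t)) c.K3 = true) &&
  decide ((∑ m' : Fin c.N₀, sumBelow (fun t => ubTerm c.DEN (c.nN m m' t).toNat) c.K3) ≤ C.Ub)

/-- ★ **All-bad class soundness**: both badness flags and the site-sum bound. [folklore] -/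
theorem class_sound_bad (hD : 0 < c.DEN) (m : Fin c.N₀) (C : ClassCertBad c.N₀ c.K3) (h : c.checkClassBad m C = true) :
    ¬ MaybeGoodAt (1 / 20) 2 c.zM (cellIdx c.N₀ c.k₀ m) ∧ ¬ MaybeGoodAt (1 / 8) 2 c.zM (cellIdx c.N₀ c.k₀ m) ∧
      (∑ q, effPot w₄₅ ω₄ (3 / 400) (dist (c.x m) (c.zM q))) ≤ (C.Ub : ℝ) := by
  simp only [checkClassBad, Bool.and_eq_true, decide_eq_true_eq] at h
  obtain ⟨⟨⟨⟨⟨hQ0, hnn⟩, hQ4⟩, hfar⟩, hscan⟩, hsum⟩ := h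
  have hD' : (0 : ℝ) < c.DEN := by exact_mod_cast hD
  set d₀ : ℝ := ((c.DEN : ℝ))⁻¹ * Real.sqrt (C.Qn : ℝ) with hd₀
  have hQ0R : (0 : ℝ) < C.Qn := by exact_mod_cast hQ0
  have hsQ : 0 < Real.sqrt (C.Qn : ℝ) := Real.sqrt_pos.2 hQ0R
  have hd₀pos : 0 < d₀ := mul_pos (inv_pos.2 hD') hsQ
  -- pinning
  have hpin : ∀ a, c.zM a ≠ c.zM (cellIdx c.N₀ c.k₀ m) → d₀ ≤ dist (c.zM a) (c.zM (cellIdx c.N₀ c.k₀ m)) := by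
    intro a ha
    have hn0 := c.nN_ne_zero_of_ne hD ha
    have h := allBelow_spec (hscan (cellμ c.N₀ c.k₀ a)) _ ((finProdFinEquiv.symm a).2).2
    simp only [Bool.or_eq_true, decide_eq_true_eq] at h
    rcases h with h0 | hQn
    · exact absurd h0 hn0
    · rw [c.dist_zM hD]
      have := c.scaled_sqrt_mono hD hQn
      simpa using this
  -- the nearest neighbour
  set qnn := finProdFinEquiv C.nn with hqnn
  have hdnn : dist (c.zM qnn) (c.zM (cellIdx c.N₀ c.k₀ m)) = d₀ := by
    rw [hqnn, show C.nn = (C.nn.1, C.nn.2) from rfl, c.dist_zM_pair hD, hnn]; simp [hd₀]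
  have hnn_ne : c.zM qnn ≠ c.zM (cellIdx c.N₀ c.k₀ m) := fun h => hd₀pos.ne' (by rw [← hdnn]; exact dist_eq_zero.2 h)
  have hnnW : ∃ a, c.zM a ≠ c.zM (cellIdx c.N₀ c.k₀ m) ∧ dist (c.zM a) (c.zM (cellIdx c.N₀ c.k₀ m)) ≤ d₀ := ⟨qnn, hnn_ne, hdnn.le⟩
  have hnear : ∃ a, a ≠ cellIdx c.N₀ c.k₀ m ∧ dist (c.zM a) (c.zM (cellIdx c.N₀ c.k₀ m)) ≤ 2 := by
    refine ⟨qnn, fun h => hnn_ne (by rw [h]), ?_⟩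
    rw [hdnn, hd₀, inv_mul_le_iff₀ hD']
    have : Real.sqrt (C.Qn : ℝ) ≤ Real.sqrt ((2 * c.DEN : ℝ) ^ 2) := Real.sqrt_le_sqrt (by
      have : (C.Qn : ℝ) ≤ 4 * (c.DEN : ℝ) ^ 2 := by exact_mod_cast hQ4
      linarith)
    rw [Real.sqrt_sq (by positivity)] at this
    linarith
  -- the far witness at `≥ 9/8·d₀`, `< 13/10·d₀`
  have hfarW : ∀ η : ℝ, η ≤ 1 / 8 → ∃ a, (1 + η) * d₀ ≤ dist (c.zM a) (c.zM (cellIdx c.N₀ c.k₀ m)) ∧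
      dist (c.zM a) (c.zM (cellIdx c.N₀ c.k₀ m)) < 13 / 10 * d₀ := by
    intro η hη
    refine ⟨finProdFinEquiv C.far, ?_, ?_⟩
    · rw [show C.far = (C.far.1, C.far.2) from rfl, c.dist_zM_pair hD, hd₀]
      have h1 : (81 : ℝ) * C.Qn ≤ 64 * (c.nN m C.far.1 C.far.2 : ℝ) := by exact_mod_cast hfar.1
      have h98 : (1 + 1 / 8) * Real.sqrt (C.Qn : ℝ) ≤ Real.sqrt (c.nN m C.far.1 C.far.2 : ℝ) := by
        rw [show (1 + 1 / 8 : ℝ) = Real.sqrt ((9 / 8) ^ 2) by rw [Real.sqrt_sq (by norm_num)]; norm_num, ← Real.sqrt_mul (by positivity)]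
        exact Real.sqrt_le_sqrt (by linarith)
      have hη' : (1 + η) * Real.sqrt (C.Qn : ℝ) ≤ (1 + 1 / 8) * Real.sqrt (C.Qn : ℝ) := mul_le_mul_of_nonneg_right (by linarith) hsQ.le
      calc (1 + η) * (((c.DEN : ℝ))⁻¹ * Real.sqrt (C.Qn : ℝ)) = ((c.DEN : ℝ))⁻¹ * ((1 + η) * Real.sqrt (C.Qn : ℝ)) := by ring
        _ ≤ ((c.DEN : ℝ))⁻¹ * Real.sqrt (c.nN m C.far.1 C.far.2 : ℝ) := mul_le_mul_of_nonneg_left (hη'.trans h98) (by positivity)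
    · rw [show C.far = (C.far.1, C.far.2) from rfl, c.dist_zM_pair hD, hd₀]
      have h1 : (100 : ℝ) * (c.nN m C.far.1 C.far.2 : ℝ) < 169 * C.Qn := by exact_mod_cast hfar.2
      have : Real.sqrt (c.nN m C.far.1 C.far.2 : ℝ) < 13 / 10 * Real.sqrt (C.Qn : ℝ) := by
        rw [show (13 / 10 : ℝ) = Real.sqrt ((13 / 10) ^ 2) by rw [Real.sqrt_sq (by norm_num)], ← Real.sqrt_mul (by positivity)]
        exact Real.sqrt_lt_sqrt (by exact_mod_cast c.nN_nonneg _ _ _) (by linarith)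
      calc ((c.DEN : ℝ))⁻¹ * Real.sqrt (c.nN m C.far.1 C.far.2 : ℝ) < ((c.DEN : ℝ))⁻¹ * (13 / 10 * Real.sqrt (C.Qn : ℝ)) :=
            mul_lt_mul_of_pos_left this (by positivity)
        _ = 13 / 10 * (((c.DEN : ℝ))⁻¹ * Real.sqrt (C.Qn : ℝ)) := by ring
  refine ⟨not_maybeGoodAt_of_radial (d₀ := d₀) (by norm_num) hpin hnnW (hfarW (1 / 20) (by norm_num)) hnear,
    not_maybeGoodAt_of_radial (d₀ := d₀) (by norm_num) hpin hnnW (hfarW (1 / 8) le_rfl) hnear, ?_⟩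
  -- the site sum (verbatim as in `class_sound`)
  have hterm : ∀ q, effPot w₄₅ ω₄ (3 / 400) (dist (c.x m) (c.zM q)) ≤
      (ubTerm c.DEN (c.nN m (cellμ c.N₀ c.k₀ q) (finProdFinEquiv.symm q).2).toNat : ℝ) := by
    intro q
    rw [dist_comm, c.dist_superMotif_centre hD m q]
    have hcast : (c.nN m (cellμ c.N₀ c.k₀ q) (finProdFinEquiv.symm q).2 : ℝ) =
        ((c.nN m (cellμ c.N₀ c.k₀ q) (finProdFinEquiv.symm q).2).toNat : ℕ) := by
      have := Int.toNat_of_nonneg (c.nN_nonneg m (cellμ c.N₀ c.k₀ q) (finProdFinEquiv.symm q).2)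
      exact_mod_cast this.symm
    rw [hcast]
    exact effPot_le_ubTerm hD _
  calc (∑ q, effPot w₄₅ ω₄ (3 / 400) (dist (c.x m) (c.zM q)))
      ≤ ∑ q, (ubTerm c.DEN (c.nN m (cellμ c.N₀ c.k₀ q) (finProdFinEquiv.symm q).2).toNat : ℝ) := Finset.sum_le_sum fun q _ => hterm q
    _ = ((∑ q, ubTerm c.DEN (c.nN m (cellμ c.N₀ c.k₀ q) (finProdFinEquiv.symm q).2).toNat : ℚ) : ℝ) := by push_cast; rfl
    _ = ((∑ m' : Fin c.N₀, sumBelow (fun t => ubTerm c.DEN (c.nN m m' t).toNat) c.K3 : ℚ) : ℝ) := by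
        congr 1
        rw [sum_cell_eq c.N₀ c.k₀ (fun m' (t : Fin ((2 * c.k₀ + 1) ^ 3)) => ubTerm c.DEN (c.nN m m' t).toNat)]
        refine Finset.sum_congr rfl fun m' _ => ?_
        rw [sumBelow_eq, ← Fin.sum_univ_eq_sum_range]
    _ ≤ (C.Ub : ℝ) := by exact_mod_cast hsum

/-- ★★ **An accepted all-bad cell certificate refutes `T′♭₄₅(κ_T; C_T)` for every `C_T`** as soon as
`Σ_m ((Ub_m + 3/200)/2 − 3/400) < N₀·(eUp + κ_T)`. [folklore] -/
theorem not_schurTopologicalPricing_fourHalf_of_checkBad (cert : Fin c.N₀ → ClassCertBad c.N₀ c.K3) (hG : c.checkGeom = true)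
    (hC : ∀ m, c.checkClassBad m (cert m) = true) {eUp κT : ℝ}
    (hκ : ((∑ m, (((cert m).Ub + 3 / 200) / 2 - 3 / 400) : ℚ) : ℝ) < c.N₀ * (eUp + κT)) (CT : ℝ) :
    ¬ SchurTopologicalPricing (1 / 20) (1 / 8) w₄₅ ω₄ (3 / 400) eUp κT CT := by
  obtain ⟨hD, hN, hsep, hdual, hb, hdiam, hk⟩ := c.geom_sound hG
  have hN' : (0 : ℝ) < c.N₀ := by exact_mod_cast hN
  set T : ℝ := ((∑ m, (((cert m).Ub + 3 / 200) / 2 - 3 / 400) : ℚ) : ℝ) with hT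
  set δ : ℝ := (c.N₀ * (eUp + κT) - T) / c.N₀ with hδ
  have hδpos : 0 < δ := div_pos (by linarith) hN'
  have hW0 : effPot w₄₅ ω₄ (3 / 400) 0 = -(3 / 200) := effPot_fourHalf_zero
  refine not_schurTopologicalPricing_of_badCell (ϱ := 9 / 2) hN hsep hdual hb hdiam hk (cellμσ_injective c.N₀ c.k₀) (abs_cellσ_le c.N₀ c.k₀)
    (cell_sup c.N₀ c.k₀) (cellIdx_spec c.N₀ c.k₀) (R := 9 / 2) (Wsup := 7) (by norm_num) (fun r hr => effPot_fourHalf_eq_zero _ hr) le_rfl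
    (fun r hr => effPot_fourHalf_le hr) (by norm_num) (D := 2) (by norm_num) (by norm_num) (by norm_num)
    (fun m => (c.class_sound_bad hD m (cert m) (hC m)).1) (fun m => (c.class_sound_bad hD m (cert m) (hC m)).2.1) hδpos ?_ CT
  have hcls : ∀ m, ((∑ q, effPot w₄₅ ω₄ (3 / 400) (dist (c.x m) (c.zM q))) - effPot w₄₅ ω₄ (3 / 400) 0) / 2 - 3 / 400 ≤
      ((((cert m).Ub + 3 / 200) / 2 - 3 / 400 : ℚ) : ℝ) := by
    intro m
    have := (c.class_sound_bad hD m (cert m) (hC m)).2.2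
    rw [hW0]; push_cast; linarith
  calc (∑ m, (((∑ q, effPot w₄₅ ω₄ (3 / 400) (dist (c.x m) (c.zM q))) - effPot w₄₅ ω₄ (3 / 400) 0) / 2 - 3 / 400))
      ≤ ∑ m, ((((cert m).Ub + 3 / 200) / 2 - 3 / 400 : ℚ) : ℝ) := Finset.sum_le_sum fun m _ => hcls m
    _ = T := by rw [hT]; push_cast; rfl
    _ = c.N₀ * (eUp + κT - δ) := by rw [hδ]; field_simp; ring

end Cell

end Summit.AtomisticToContinuum.Crystallization.Theorems.FrustratedLawDichotomyCellChecker

end
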